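import Summits.BirchSwinnertonDyer.BirchSwinnertonDyer.Theorems.CyclotomicUntwistFormalEtaCoboundaryPrep
import HarnessLib

/-!
# Route `CyclotomicUntwist`: the class of `η = x·ω` is of the SECOND KIND — the coboundary of
# `formalEtaIntegral` under the chord–tangent law in CLOSED FORM (the formal `ζ`-addition law), hence INTEGRAL

Cell `pub/bsd-wall` (D-0145 line `route-BirchSwinnertonDyer-CyclotomicUntwist`), prover seat `bsd-line-cycu-p5`
(gen 10), lane «the η-class is of the second kind». THEOREMS ONLY (no definition, no named fact, no `sorry`);
helper `--supports` K1 = stmt-BirchSwinnertonDyer-21580 (serves K2 = 21581 and the print input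
`isDescendedFrobeniusMatrix_exists` of C2 = 27549). BSD is not proved by this file and no crux is.

WHAT. The Literature definition `WeierstrassCurve.formalEtaIntegral` (`DescendedFrobeniusMatrix.lean`) represents the
de Rham class of `η = x·ω` in Katz's module `D(Ê/R) = {f : f(0) = 0, df integral, ∂f integral}/{integral}`
([Katz 1981, §5.1 p. 193]) by the regular series `L_η = ∫(xω − dz/z²) = Σ_{n ≥ 1} (P_{n+1}/n) zⁿ`,
`P = z²x·(ω/dz)`. For `[η]` to BE an element of `D(Ê/R)` its coboundary
`∂L_η := L_η(F(z₁,z₂)) − L_η(z₁) − L_η(z₂)` (`F = formalGroupLaw`, AEC IV.1) must have coefficients in `R`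
(primitivity; the `[ω]`-half is `log F = log z₁ + log z₂`, `formalLog_subst_formalGroupLaw`). We prove (Part II;
the inputs are in `…FormalEtaCoboundaryPrep.lean`) the CLOSED FORM, for every Weierstrass curve over a `ℚ`-algebra domain,

  `∂L_η = a₁ − (a₁ + a₃λ + a₄ν + 2a₆λν)·(1 − a₃ν − a₆ν²)⁻¹ + a₃·z₃²·B(z₃)`     (`formalEtaIntegral_coboundary_eq`)

(`λ = formalSlope`, `ν = formalIntercept`, `z₃ = formalChordZ`, `B = formalWDivCube`, all with coefficients in
`ℤ[a₁,…,a₆]`), i.e. the `z`-expansion of the classical addition law of the Weierstrass `ζ`-function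
`ζ(u+v) − ζ(u) − ζ(v) = ½(℘′(u) − ℘′(v))/(℘(u) − ℘(v))` with the polar parts `1/z` removed:
`∂L_η = 1/F − 1/z₁ − 1/z₂ − λ/ν` (`λ/ν` = the `(x,y)`-slope of the chord), rewritten through Vieta for the chord
cubic (`D·z₁z₂z₃ = ν(1 − a₃ν − a₆ν²)`, `D·(z₁z₂ + z₁z₃ + z₂z₃) = c₁`) into a power series. PROOF: both sides vanish
at `z = 0` and have the same partial derivatives: `ηᵢ·∂ᵢ(∂L_η) = q(F) − q(zᵢ)` with `q = (z²x − η)/z²`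
(invariance `ηᵢ∂ᵢF = η(F)`), while `∂ᵢ` of the right side is computed from `ηᵢ∂ᵢλ = D(zᵢ − z₃)`,
`∂ᵢν = −zⱼ∂ᵢλ` (the differentiated incidences) and reduces, after clearing denominators, to `x(F) − xᵢ =
ν(z₃ − zᵢ)/(wᵢw₃)` and the Vieta product `D·w₁w₂w₃ = ν³`. CONSEQUENCE (`coeff_coboundary_mem_range`): for a
Weierstrass equation with coefficients in a subring `R → A`, every coefficient of `∂L_η` lies in `R` — in
particular for a good model over `𝓞 = 𝓞_{ℚ₃(ζ₉)}` the class `classEta` has `𝓞`-INTEGRAL coboundary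
(`isIntegral_coeff_coboundary_formalEtaIntegral`), so `[η] ∈ D(Ê/𝓞)` (Katz L. 5.1.2 + primitivity, in kernel).
[cite: Katz1981CrystallineDieudonne, §5.1 (p. 193), Lemma 5.1.2] [cite: SilvermanAEC2009, IV.1, III.5.1]
-/

set_option autoImplicit false
-- single-conjunct summit: `Summit.BirchSwinnertonDyer.BirchSwinnertonDyer.…` repeats the name by design
set_option linter.dupNamespace false

noncomputable section

open PowerSeries Literature.NumberTheory.EllipticCurves
open Literature.AlgebraicGeometry.Resolution (MvPowerSeries.pderiv MvPowerSeries.coeff_pderiv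
  MvPowerSeries.pderiv_X MvPowerSeries.pderiv_C MvPowerSeries.pderiv_powerSeries_subst
  MvPowerSeries.pderiv_powerSeries_subst_X MvPowerSeries.coeff_eq_zero_of_pderiv_eq_zero)

namespace Summit.BirchSwinnertonDyer.BirchSwinnertonDyer.Theorems.FormalEtaCoboundary

/-! ## §3 The closed form: `∂L_η = a₁ − (a₁ + a₃λ + a₄ν + 2a₆λν)(1 − a₃ν − a₆ν²)⁻¹ + a₃ z₃² B(z₃)` -/

section Main

variable {A : Type*} [CommRing A] [IsDomain A] [Algebra ℚ A] (V : WeierstrassCurve A)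

omit [IsDomain A] in
/-- `∂ᵢ (L_η(F) − L_η(z₁) − L_η(z₂)) = L_η′(F)·∂ᵢF − L_η′(zᵢ)` (chain rule). [folklore] -/
theorem pderiv_coboundary (i : Fin 2) :
    MvPowerSeries.pderiv i (V.formalEtaIntegral.subst V.formalGroupLaw -
        V.formalEtaIntegral.subst (MvPowerSeries.X 0 : MvPowerSeries (Fin 2) A) -
        V.formalEtaIntegral.subst (MvPowerSeries.X 1 : MvPowerSeries (Fin 2) A)) =
      (d⁄dX A V.formalEtaIntegral).subst V.formalGroupLaw * MvPowerSeries.pderiv i V.formalGroupLaw -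
        (d⁄dX A V.formalEtaIntegral).subst (MvPowerSeries.X i : MvPowerSeries (Fin 2) A) := by
  classical
  rw [map_sub, map_sub, MvPowerSeries.pderiv_powerSeries_subst V.constantCoeff_formalGroupLaw,
    MvPowerSeries.pderiv_powerSeries_subst_X, MvPowerSeries.pderiv_powerSeries_subst_X]
  fin_cases i <;> simp

omit [IsDomain A] in
/-- Substituted form of `z²·(η·L_η′) = z²x − η`: `g² · (η L_η′)(g) = (z²x)(g) − η(g)`. [folklore] -/
theorem subst_sq_mul_q {g : MvPowerSeries (Fin 2) A} (hg : PowerSeries.HasSubst g) :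
    g ^ 2 * (V.formalEta * d⁄dX A V.formalEtaIntegral).subst g = V.formalXMulSq.subst g - V.formalEta.subst g := by
  have h := congrArg (PowerSeries.subst g) (X_sq_mul_formalEta_mul_derivative_formalEtaIntegral V)
  rw [PowerSeries.subst_mul hg, PowerSeries.subst_pow hg, PowerSeries.subst_X hg, PowerSeries.subst_sub hg] at h
  exact h

/-- Substituted form of `(z²x)·w = z³`: `(z²x)(g) · w(g) = g³`. [folklore] -/
theorem subst_formalXMulSq_mul_formalW {R : Type*} [CommRing R] (W : WeierstrassCurve R)
    {g : MvPowerSeries (Fin 2) R} (hg : PowerSeries.HasSubst g) :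
    W.formalXMulSq.subst g * W.formalW.subst g = g ^ 3 := by
  rw [← PowerSeries.subst_mul hg, W.formalXMulSq_mul_formalW, PowerSeries.subst_pow hg, PowerSeries.subst_X hg]

omit [IsDomain A] [Algebra ℚ A] in
/-- `zᵢ ≠ 0` in `A⟦z₁, z₂⟧`. [folklore] -/
theorem X_ne_zero' [Nontrivial A] (i : Fin 2) : (MvPowerSeries.X i : MvPowerSeries (Fin 2) A) ≠ 0 := by
  classical
  intro h
  have := congrArg (MvPowerSeries.coeff (Finsupp.single i 1)) h
  rw [MvPowerSeries.coeff_index_single_X, if_pos rfl, map_zero] at this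
  exact one_ne_zero this

omit [IsDomain A] [Algebra ℚ A] in
/-- `z₃ ≠ 0` (its `z₁`-coefficient is `−1`). [folklore] -/
theorem formalChordZ_ne_zero [Nontrivial A] : V.formalChordZ ≠ 0 := by
  intro h
  have := V.coeff_single_formalChordZ 0
  rw [h, map_zero] at this
  norm_num at this

/-- **The heart: `∂ᵢ(∂L_η − Φ) = 0`** for the closed form `Φ`. With `δ = ∂ᵢ`, `ηᵢ = η(zᵢ)`:
`ηᵢ·δ(∂L_η) = q(F) − q(zᵢ)` (`q = η·L_η′`, invariance `ηᵢ δF = η(F)`); differentiating the bridge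
`Fνz₁z₂·Φ = ν(z₁z₂ − F(z₁+z₂)) − λFz₁z₂` and using `ηᵢδλ = D(zᵢ − z₃)`, `δν = −zⱼδλ` expresses
`(Fνz₁z₂)²ηᵢ·δΦ`; the two agree by `x(F) − xᵢ = ν(z₃ − zᵢ)/(wᵢw₃)` (`q·z² = z²x − η`, `(z²x)·w = z³`,
`F·u = −z₃`, `w(F)·u = −w₃`) and Vieta `D w₁w₂w₃ = ν³`. [cite: SilvermanAEC2009, III.5.1] -/
theorem pderiv_cobDefect (i : Fin 2) :
    MvPowerSeries.pderiv i (V.formalEtaIntegral.subst V.formalGroupLaw -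
        V.formalEtaIntegral.subst (MvPowerSeries.X 0 : MvPowerSeries (Fin 2) A) -
        V.formalEtaIntegral.subst (MvPowerSeries.X 1 : MvPowerSeries (Fin 2) A) -
      (MvPowerSeries.C V.a₁ - (MvPowerSeries.C V.a₁ + MvPowerSeries.C V.a₃ * V.formalSlope +
            MvPowerSeries.C V.a₄ * V.formalIntercept + 2 * MvPowerSeries.C V.a₆ * V.formalSlope * V.formalIntercept) *
          MvPowerSeries.invOfUnit (1 - MvPowerSeries.C V.a₃ * V.formalIntercept -
            MvPowerSeries.C V.a₆ * V.formalIntercept ^ 2) 1 +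
          MvPowerSeries.C V.a₃ * (V.formalChordZ ^ 2 * V.formalWDivCube.subst V.formalChordZ))) = 0 := by
  classical
  -- opaque names
  obtain ⟨Φ, hΦ⟩ : ∃ Φ : MvPowerSeries (Fin 2) A, Φ = MvPowerSeries.C V.a₁ - (MvPowerSeries.C V.a₁ +
      MvPowerSeries.C V.a₃ * V.formalSlope + MvPowerSeries.C V.a₄ * V.formalIntercept +
      2 * MvPowerSeries.C V.a₆ * V.formalSlope * V.formalIntercept) *
        MvPowerSeries.invOfUnit (1 - MvPowerSeries.C V.a₃ * V.formalIntercept -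
          MvPowerSeries.C V.a₆ * V.formalIntercept ^ 2) 1 +
        MvPowerSeries.C V.a₃ * (V.formalChordZ ^ 2 * V.formalWDivCube.subst V.formalChordZ) := ⟨_, rfl⟩
  obtain ⟨Ψ, hΨ⟩ : ∃ Ψ : MvPowerSeries (Fin 2) A, Ψ = V.formalEtaIntegral.subst V.formalGroupLaw -
      V.formalEtaIntegral.subst (MvPowerSeries.X 0 : MvPowerSeries (Fin 2) A) -
      V.formalEtaIntegral.subst (MvPowerSeries.X 1 : MvPowerSeries (Fin 2) A) := ⟨_, rfl⟩
  rw [← hΦ, ← hΨ]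
  set δ := MvPowerSeries.pderiv (R := A) i with hδ
  set zi := (MvPowerSeries.X i : MvPowerSeries (Fin 2) A) with hzi
  set zj := (MvPowerSeries.X 0 : MvPowerSeries (Fin 2) A) + MvPowerSeries.X 1 - MvPowerSeries.X i with hzj
  have hF := V.hasSubst_formalGroupLaw
  have hXi : PowerSeries.HasSubst zi := PowerSeries.HasSubst.X i
  have hz₃ := V.hasSubst_formalChordZ
  -- the variables
  have hδzi : δ zi = 1 := by rw [hzi, hδ, MvPowerSeries.pderiv_X, if_pos rfl]
  have hδzj : δ zj = 0 := by
    rw [hzj, hδ, map_sub, map_add, MvPowerSeries.pderiv_X, MvPowerSeries.pderiv_X, MvPowerSeries.pderiv_X,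
      if_pos rfl]
    fin_cases i <;> simp
  have hmul : zi * zj = (MvPowerSeries.X 0 : MvPowerSeries (Fin 2) A) * MvPowerSeries.X 1 := X_mul_other i
  have hadd : zi + zj = (MvPowerSeries.X 0 : MvPowerSeries (Fin 2) A) + MvPowerSeries.X 1 := by rw [hzj]; ring
  -- δΨ and the invariance
  have hδΨ : δ Ψ = (d⁄dX A V.formalEtaIntegral).subst V.formalGroupLaw * δ V.formalGroupLaw -
      (d⁄dX A V.formalEtaIntegral).subst zi := by rw [hΨ]; exact pderiv_coboundary V i
  have hηdF : V.formalEta.subst zi * δ V.formalGroupLaw = V.formalEta.subst V.formalGroupLaw :=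
    V.formalEta_subst_X_mul_pderiv_formalGroupLaw i
  -- `q = η · L_η′` at `F` and at `zᵢ`
  have hqF' : (V.formalEta * d⁄dX A V.formalEtaIntegral).subst V.formalGroupLaw =
      V.formalEta.subst V.formalGroupLaw * (d⁄dX A V.formalEtaIntegral).subst V.formalGroupLaw :=
    PowerSeries.subst_mul hF _ _
  have hqi' : (V.formalEta * d⁄dX A V.formalEtaIntegral).subst zi =
      V.formalEta.subst zi * (d⁄dX A V.formalEtaIntegral).subst zi := PowerSeries.subst_mul hXi _ _
  have hqF := subst_sq_mul_q V hF
  have hqi := subst_sq_mul_q V hXi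
  have hTF := subst_formalXMulSq_mul_formalW V hF
  have hTi := subst_formalXMulSq_mul_formalW V hXi
  have hT₃ := subst_formalXMulSq_mul_formalW V hz₃
  -- the chord: `wᵢ = λzᵢ + ν`, `w(z₃) = λz₃ + ν`, `F u = −z₃`, `w(F) u = −w₃`, Vieta
  have hwi := formalSlope_mul_X_add_formalIntercept V i
  have hw₃ := V.formalW_subst_formalChordZ
  have hFu := V.formalGroupLaw_mul_formalNegDenom
  have hwFu := V.formalW_subst_formalGroupLaw_mul_formalNegDenom
  have hV3 : V.formalChordDenom * (V.formalSlope ^ 2 * (zi * zj) + V.formalSlope * V.formalIntercept * (zi + zj) +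
      V.formalIntercept ^ 2) * (V.formalSlope * V.formalChordZ + V.formalIntercept) = V.formalIntercept ^ 3 := by
    rw [hmul, hadd]; linear_combination formalChordDenom_mul_prod_w V
  -- the differentiated incidences
  obtain ⟨hdL, hdV⟩ := formalEta_mul_pderiv_formalSlope V i
  rw [← hδ] at hdL hdV
  have hdV' : V.formalEta.subst zi * δ V.formalIntercept =
      -zj * (V.formalChordDenom * (zi - V.formalChordZ)) := by
    rw [hdV]; linear_combination (-zj) * hdL
  -- the bridge, in the variables `zᵢ, zⱼ`, and its derivative
  have hB : V.formalGroupLaw * V.formalIntercept * (zi * zj) * Φ =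
      V.formalIntercept * (zi * zj - V.formalGroupLaw * (zi + zj)) -
        V.formalSlope * V.formalGroupLaw * (zi * zj) := by
    have hb := bridge V
    rw [← hΦ] at hb
    linear_combination hb + (V.formalGroupLaw * V.formalIntercept * Φ - V.formalIntercept +
      V.formalSlope * V.formalGroupLaw) * hmul + (V.formalIntercept * V.formalGroupLaw) * hadd
  have E1 := congrArg δ hB
  simp only [map_sub, map_add, Derivation.leibniz, smul_eq_mul, hδzi, hδzj, mul_one, mul_zero,
    add_zero, zero_add] at E1
  -- non-vanishing of the factors to be cancelled
  have hzi0 : zi ≠ 0 := X_ne_zero' i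
  have hz₃0 : V.formalChordZ ≠ 0 := formalChordZ_ne_zero V
  have hu : IsUnit (1 - MvPowerSeries.C V.a₁ * V.formalChordZ -
      MvPowerSeries.C V.a₃ * (V.formalSlope * V.formalChordZ + V.formalIntercept)) :=
    V.isUnit_formalNegDenom_formalChordZ
  have hF0 : V.formalGroupLaw ≠ 0 := by
    intro h; rw [h, zero_mul, zero_add] at hFu; exact hz₃0 hFu
  have hwi0 : V.formalW.subst zi ≠ 0 := by
    intro h; rw [h, mul_zero] at hTi; exact pow_ne_zero 3 hzi0 hTi.symm
  have hwF0 : V.formalW.subst V.formalGroupLaw ≠ 0 := by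
    intro h; rw [h, mul_zero] at hTF; exact pow_ne_zero 3 hF0 hTF.symm
  have hw₃0 : V.formalSlope * V.formalChordZ + V.formalIntercept ≠ 0 := by
    intro h; rw [← hw₃] at h; rw [h, mul_zero] at hT₃; exact pow_ne_zero 3 hz₃0 hT₃.symm
  have hzj0 : zj ≠ 0 := by
    rw [hzj]; fin_cases i
    · simpa using X_ne_zero' (A := A) 1
    · simpa using X_ne_zero' (A := A) 0
  have hwj0 : V.formalSlope * zj + V.formalIntercept ≠ 0 := by
    have : V.formalSlope * zj + V.formalIntercept = V.formalW.subst zj := by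
      rw [hzj]; fin_cases i
      · simpa using V.formalSlope_mul_X_one_add_formalIntercept
      · simpa using V.formalSlope_mul_X_zero_add_formalIntercept
    rw [this]
    have hzj' : PowerSeries.HasSubst zj := PowerSeries.HasSubst.of_constantCoeff_zero (by rw [hzj]; simp)
    have hT := subst_formalXMulSq_mul_formalW V hzj'
    intro h; rw [h, mul_zero] at hT; exact pow_ne_zero 3 hzj0 hT.symm
  have hV0 : V.formalIntercept ≠ 0 := by
    intro h
    have h3 : V.formalChordDenom * V.formalSlope ^ 3 * V.formalChordZ * (zi * zj) = 0 := by
      have h3 := hV3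
      rw [h] at h3
      linear_combination h3
    rcases mul_eq_zero.mp h3 with h4 | h4
    · rcases mul_eq_zero.mp h4 with h5 | h5
      · rcases mul_eq_zero.mp h5 with h6 | h6
        · exact V.formalChordDenom_ne_zero h6
        · -- `λ = 0` would force `wᵢ = ν = 0`
          have hL0 : V.formalSlope = 0 := (pow_eq_zero_iff three_ne_zero).mp h6
          have : V.formalW.subst zi = 0 := by rw [← hwi, h, hL0]; ring
          exact hwi0 this
      · exact hz₃0 h5
    · exact mul_ne_zero hzi0 hzj0 h4
  have hηi : IsUnit (V.formalEta.subst zi) := by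
    rw [MvPowerSeries.isUnit_iff_constantCoeff, V.formalEta_subst hXi]
    simp [hzi, constantCoeff_powerSeries_subst_eq_zero (MvPowerSeries.constantCoeff_X i) V.constantCoeff_formalW]
  -- ABBREVIATIONS
  set F := V.formalGroupLaw with hFdef
  set L := V.formalSlope
  set N := V.formalIntercept
  set D := V.formalChordDenom
  set z₃ := V.formalChordZ
  set wi := V.formalW.subst zi
  set wF := V.formalW.subst F
  set TF := V.formalXMulSq.subst F
  set Ti := V.formalXMulSq.subst zi
  set ηi := V.formalEta.subst zi
  set ηF := V.formalEta.subst F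
  set eF := (d⁄dX A V.formalEtaIntegral).subst F
  set ei := (d⁄dX A V.formalEtaIntegral).subst zi
  set qF := (V.formalEta * d⁄dX A V.formalEtaIntegral).subst F
  set qi := (V.formalEta * d⁄dX A V.formalEtaIntegral).subst zi
  set u := 1 - MvPowerSeries.C V.a₁ * z₃ - MvPowerSeries.C V.a₃ * (L * z₃ + N)
  set dF := δ F
  set dL := δ L
  set dN := δ N
  set dΦ := δ Φ
  -- (A) `ηᵢ δΨ = q(F) − q(zᵢ)` and the x-difference
  have hA : ηi * δ Ψ = qF - qi := by
    rw [hδΨ]; linear_combination eF * hηdF - hqF' + hqi'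
  have hX : (qF - qi) * F ^ 2 * zi ^ 2 * wi * wF =
      zi ^ 2 * wi * F ^ 3 - zi ^ 2 * wi * wF * ηF - F ^ 2 * wF * zi ^ 3 + F ^ 2 * wi * wF * ηi := by
    linear_combination (zi ^ 2 * wi * wF) * hqF - (F ^ 2 * wi * wF) * hqi + (zi ^ 2 * wi) * hTF -
      (F ^ 2 * wF) * hTi
  -- (B) `(Fνzᵢzⱼ)² ηᵢ δΦ` from the differentiated bridge
  have E2 : (F * N * (zi * zj)) ^ 2 * (ηi * dΦ) =
      F * N * (zi * zj) * ((-zj * (D * (zi - z₃))) * (zi * zj - F * (zi + zj)) +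
          N * (ηi * zj - ηF * (zi + zj) - ηi * F) -
          (D * (zi - z₃) * F * (zi * zj) + L * ηF * (zi * zj) + ηi * L * F * zj)) -
        (ηF * N * (zi * zj) - zj * (D * (zi - z₃)) * F * (zi * zj) + ηi * F * N * zj) *
          (N * (zi * zj - F * (zi + zj)) - L * F * (zi * zj)) := by
    linear_combination (ηi * F * N * (zi * zj)) * E1 -
      (ηi * dF * N * (zi * zj) + F * (ηi * dN) * (zi * zj) + ηi * F * N * zj) * hB +
      (F * N * (zi * zj) * (-N * (zi + zj) - L * (zi * zj)) - N * (zi * zj) *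
        (N * (zi * zj - F * (zi + zj)) - L * F * (zi * zj))) * hηdF +
      (F * N * (zi * zj) * (zi * zj - F * (zi + zj)) - F * (zi * zj) *
        (N * (zi * zj - F * (zi + zj)) - L * F * (zi * zj))) * hdV' +
      (F * N * (zi * zj) * (-F * (zi * zj))) * hdL
  -- (C) the two sides agree after clearing denominators
  have K : (F * N * (zi * zj)) ^ 2 * (wi * wF * u) * (ηi * (δ Ψ - dΦ)) = 0 := by
    linear_combination ((F * N * (zi * zj)) ^ 2 * (wi * wF * u)) * hA - (wi * wF * u) * E2 +
      (N ^ 2 * zj ^ 2 * u) * hX + (zi ^ 2 * zj ^ 2 * F ^ 2 * (N ^ 2 * wi)) * hFu +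
      (zi ^ 2 * zj ^ 2 * F ^ 2 * (D * (zi - z₃) * wi * (L * zj + N) - N ^ 2 * zi)) * hwFu +
      (zi ^ 2 * zj ^ 2 * F ^ 2 * (N ^ 2 * z₃ + (zi - z₃) * D * (L * zj + N) * (L * z₃ + N))) * hwi -
      (zi ^ 2 * zj ^ 2 * F ^ 2 * (zi - z₃)) * hV3
  -- cancel the non-zero factors
  have hne : (F * N * (zi * zj)) ^ 2 * (wi * wF * u) ≠ 0 :=
    mul_ne_zero (pow_ne_zero 2 (mul_ne_zero (mul_ne_zero hF0 hV0) (mul_ne_zero hzi0 hzj0)))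
      (mul_ne_zero (mul_ne_zero hwi0 hwF0) hu.ne_zero)
  have h1 : ηi * (δ Ψ - dΦ) = 0 := (mul_eq_zero.mp K).resolve_left hne
  rw [map_sub]
  exact (hηi.mul_right_eq_zero).mp h1

omit [IsDomain A] in
/-- The defect `∂L_η − Φ` has zero constant term (`L_η(0) = 0`; `Φ(0) = a₁ − a₁·1 + 0`). [folklore] -/
theorem constantCoeff_cobDefect :
    MvPowerSeries.constantCoeff (V.formalEtaIntegral.subst V.formalGroupLaw -
        V.formalEtaIntegral.subst (MvPowerSeries.X 0 : MvPowerSeries (Fin 2) A) -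
        V.formalEtaIntegral.subst (MvPowerSeries.X 1 : MvPowerSeries (Fin 2) A) -
      (MvPowerSeries.C V.a₁ - (MvPowerSeries.C V.a₁ + MvPowerSeries.C V.a₃ * V.formalSlope +
            MvPowerSeries.C V.a₄ * V.formalIntercept + 2 * MvPowerSeries.C V.a₆ * V.formalSlope * V.formalIntercept) *
          MvPowerSeries.invOfUnit (1 - MvPowerSeries.C V.a₃ * V.formalIntercept -
            MvPowerSeries.C V.a₆ * V.formalIntercept ^ 2) 1 +
          MvPowerSeries.C V.a₃ * (V.formalChordZ ^ 2 * V.formalWDivCube.subst V.formalChordZ))) = 0 := by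
  have h0 : ∀ {g : MvPowerSeries (Fin 2) A}, MvPowerSeries.constantCoeff g = 0 →
      MvPowerSeries.constantCoeff (V.formalEtaIntegral.subst g) = 0 := fun hg =>
    constantCoeff_powerSeries_subst_eq_zero hg V.constantCoeff_formalEtaIntegral
  simp [h0 V.constantCoeff_formalGroupLaw, h0 (MvPowerSeries.constantCoeff_X 0), h0 (MvPowerSeries.constantCoeff_X 1),
    V.constantCoeff_formalSlope, V.constantCoeff_formalIntercept, V.constantCoeff_formalChordZ,
    MvPowerSeries.constantCoeff_invOfUnit]

/-- **The formal `ζ`-addition law (closed form of the coboundary of the `η`-integral).** For every Weierstrass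
curve over a `ℚ`-algebra domain, with `L_η = formalEtaIntegral = ∫(xω − dz/z²)`, `F` the chord–tangent formal
group law, `λ = formalSlope`, `ν = formalIntercept`, `z₃ = formalChordZ`, `B = w/z³ = formalWDivCube`:
`L_η(F(z₁,z₂)) − L_η(z₁) − L_η(z₂) = a₁ − (a₁ + a₃λ + a₄ν + 2a₆λν)·(1 − a₃ν − a₆ν²)⁻¹ + a₃·z₃²·B(z₃)`
— the `z`-expansion of `ζ(u+v) − ζ(u) − ζ(v) = ½(℘′(u) − ℘′(v))/(℘(u) − ℘(v))` with the poles `1/z` removed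
(`= 1/F − 1/z₁ − 1/z₂ − λ/ν`). In particular the coboundary has coefficients in `ℤ[a₁, …, a₆]`: the class
`[η]` is PRIMITIVE, i.e. an element of Katz's `D(Ê/R)`. [cite: Katz1981CrystallineDieudonne, §5.1 (p. 193), Lemma 5.1.2]
[cite: SilvermanAEC2009, III.5.1] -/
theorem formalEtaIntegral_coboundary_eq :
    V.formalEtaIntegral.subst V.formalGroupLaw -
        V.formalEtaIntegral.subst (MvPowerSeries.X 0 : MvPowerSeries (Fin 2) A) -
        V.formalEtaIntegral.subst (MvPowerSeries.X 1 : MvPowerSeries (Fin 2) A) =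
      MvPowerSeries.C V.a₁ - (MvPowerSeries.C V.a₁ + MvPowerSeries.C V.a₃ * V.formalSlope +
            MvPowerSeries.C V.a₄ * V.formalIntercept + 2 * MvPowerSeries.C V.a₆ * V.formalSlope * V.formalIntercept) *
          MvPowerSeries.invOfUnit (1 - MvPowerSeries.C V.a₃ * V.formalIntercept -
            MvPowerSeries.C V.a₆ * V.formalIntercept ^ 2) 1 +
        MvPowerSeries.C V.a₃ * (V.formalChordZ ^ 2 * V.formalWDivCube.subst V.formalChordZ) := by
  haveI : IsAddTorsionFree A := IsAddTorsionFree.of_module_rat (M := A)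
  rw [← sub_eq_zero]
  set H := V.formalEtaIntegral.subst V.formalGroupLaw -
        V.formalEtaIntegral.subst (MvPowerSeries.X 0 : MvPowerSeries (Fin 2) A) -
        V.formalEtaIntegral.subst (MvPowerSeries.X 1 : MvPowerSeries (Fin 2) A) -
      (MvPowerSeries.C V.a₁ - (MvPowerSeries.C V.a₁ + MvPowerSeries.C V.a₃ * V.formalSlope +
            MvPowerSeries.C V.a₄ * V.formalIntercept + 2 * MvPowerSeries.C V.a₆ * V.formalSlope * V.formalIntercept) *
          MvPowerSeries.invOfUnit (1 - MvPowerSeries.C V.a₃ * V.formalIntercept -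
            MvPowerSeries.C V.a₆ * V.formalIntercept ^ 2) 1 +
          MvPowerSeries.C V.a₃ * (V.formalChordZ ^ 2 * V.formalWDivCube.subst V.formalChordZ)) with hH
  ext d
  rw [map_zero]
  by_cases h0 : d 0 = 0
  · by_cases h1 : d 1 = 0
    · have hd : d = 0 := by
        ext j; fin_cases j
        · simpa using h0
        · simpa using h1
      rw [hd, MvPowerSeries.coeff_zero_eq_constantCoeff_apply, hH]
      exact constantCoeff_cobDefect V
    · exact MvPowerSeries.coeff_eq_zero_of_pderiv_eq_zero (pderiv_cobDefect V 1) h1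
  · exact MvPowerSeries.coeff_eq_zero_of_pderiv_eq_zero (pderiv_cobDefect V 0) h0

end Main

end Summit.BirchSwinnertonDyer.BirchSwinnertonDyer.Theorems.FormalEtaCoboundary

end
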